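import Literature.RepresentationTheory.MautnerPhenomenon
import Literature.NumberTheory.Automorphic.CuspidalTestVector
import Literature.NumberTheory.Automorphic.SmoothedCuspFormGeneric
import Literature.NumberTheory.Automorphic.WhittakerCoeffLocalDatum
import Literature.NumberTheory.Automorphic.StrongApproximationSL2
import Literature.NumberTheory.Automorphic.GlobalAdditiveCharacterProofs
import Literature.NumberTheory.Automorphic.GLnCuspidalSpectrumProofs
import Literature.NumberTheory.Automorphic.HeckeEigenvectorProjection
import Literature.NumberTheory.Automorphic.SiegelSetVolume
import Mathlib.Topology.Algebra.Valued.WithZeroMulInt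
import HarnessLib

/-!
# Howe–Moore decay at one finite place for cuspidal representations of `GL₂`, via Mautner

Topic `NumberTheory/Automorphic`; namespace `Literature.NumberTheory.Automorphic`. A brick of the local
half of the printed proof of Arthur–Clozel (2.3) in rank `2` (the named fact
`JacquetShalika1981_partialPairL_pole_of_eq_conj` of `PairLFunctionPoles`, reduced by
`PairLFunctionPolesEqConjFirstMoment` to the absolute convergence AT `s = 1` of the bad-place part of the
unfolded Rankin–Selberg integral, i.e. — for `n = 2` — to the square-integrability near `0` of the
Kirillov functions `y ↦ W_φ(diag(y, 1) g)` of smoothed cusp forms at the places `v ∈ S ∪ S_∞`;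
Jacquet–Shalika, *Euler products I* (1981), §1 and Prop. (3.17)). The Kirillov functions of a smooth
vector have finite asymptotic expansions in characters near `0` (Jacquet module; to come), and the
characters which are bounded but do not decay — the obstruction to square-integrability — are excluded
by the **vanishing at infinity of the matrix coefficients of a cuspidal `Π` along the torus of one local
factor `GL₂(K_v)`**, which this file proves in the honest `L²` model and WITHOUT the unitary dual of
`GL₂(K_v)` (Howe–Moore (1979), Thm. 5.1 (irreducible representations of connected reductive groups over local fields) and Thm. 5.2 (simple groups, no finite-dimensional subrepresentations), for this action; here from Mautner's lemma and the genericity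
of cusp forms):

* `SL2Mautner.upper/lower/torus/weyl/diagOne/conjSL` — the elementary elements of `SL₂(F)` and
  `diag(t, 1) ∈ GL₂(F)` over a field, the Bruhat relation
  `n(s) = n̄(s⁻¹) diag(s, s⁻¹) w⁻¹ n̄(s⁻¹)` (`upper_eq_lower_mul_torus_mul_weyl_inv_mul_lower`),
  `w diag(t⁻¹, t) w⁻¹ = diag(t, t⁻¹)`, the contraction `diag(t,1)⁻¹ n̄(x) diag(t,1) = n̄(t x)` and the
  generation of `SL₂(F)` by `n(x)`, `n̄(x)` (`subgroup_eq_top_of_forall_upper_lower`, Whitehead's lemma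
  of `StrongApproximationSL2`);
* `tendsto_inner_zero_of_forall_mem` — Hilbert-space lemma: a bounded family whose inner products
  with the members of a TOTAL set tend to `0` converges weakly to `0`;
* `neBot_comap_units_val_nhds_zero_adicCompletion` — the units of `K_v` accumulate at `0`;
* `rightRegular_toAdelic_apply_eq_of_forall_lower` (**Mautner at `v`**) — an `L²` automorphic form on
  `GL₂` fixed by the lower unipotents `ι_v(n̄(x))`, `x ∈ K_v`, is fixed by `ι_v(SL₂(K_v))`
  (`Literature.RepresentationTheory.mautner_torus/weyl/lower` for the regular representation);
* `CuspidalAutomorphicRepGL.eq_zero_of_forall_lower_apply_eq` (**no `N̄(K_v)`-invariant vectors in a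
  cuspidal `Π`**) — such a vector of an irreducible `Π ≤ L²_cusp(GL₂)` is `0`: by Mautner it is
  `SL₂(K_v)`-invariant; `ι_v(SL₂(K_v))` is normalised by `GL₂(𝔸_K)` (`GLn.awayFrom` calculus), so the
  `SL₂(K_v)`-invariants form a closed invariant subspace, which by irreducibility would be all of `Π`;
  but then the smoothed test vector `S_η f ≠ 0` of `CuspidalTestVector` would have a Whittaker
  coefficient with `W(g) = ψ_v(y) W(g)` for all `y ∈ K_v` (`whittakerCoeff_unipotent_mul`,
  `whittakerCharFun_ofLocal`), i.e. `W ≡ 0` as `ψ_v ≠ 1` (`adicComponent_adeleAddChar_ne_one`),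
  contradicting the genericity of smoothed cusp forms
  (`exists_whittakerCoeff_invQuot_smoothedForm_ne_zero_of_one_le`);
* `CuspidalAutomorphicRepGL.tendsto_inner_rightRegular_diagOne` (**main; Howe–Moore decay along the
  mirabolic torus**) — for `u ∈ Π` and every `w ∈ L²`,
  `⟪R(ι_v(diag(t, 1))) u, w⟫ → 0` as the unit `t` of `K_v` tends to `0`. Proof: the set
  `Y = {R(ι_v n̄(x))⁻¹ y - y} ∪ Π^⊥` is total by the previous theorem, and the inner products of
  `R(ι_v(diag(t,1))) u` with its members tend to `0` — with `Π^⊥` they vanish, and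
  `R(ι_v n̄(x)) R(ι_v diag(t,1)) u - R(ι_v diag(t,1)) u = R(ι_v diag(t,1)) (R(ι_v n̄(t x)) u - u) → 0`
  by the contraction and the strong continuity of `R`.

Everything is proved; no definition beyond the six elementary matrices, no named fact, no instance.

## References

* R. Howe, C. C. Moore, *Asymptotic properties of unitary representations*, J. Funct. Anal. 32
  (1979), 72–96, Thm. 5.1 ("the matrix coefficients of ρ vanish at ∞") and Thm. 5.2 [HoweMoore1979].
* F. I. Mautner, *Geodesic flows on symmetric Riemann spaces*, Ann. of Math. 65 (1957) [Mautner1957];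
  M. Einsiedler, T. Ward, *Functional Analysis, Spectral Theory, and Applications* (2017), Prop. 10.41
  [EinsiedlerWard2017].
* H. Jacquet, J. A. Shalika, *On Euler products and the classification of automorphic representations
  I*, Amer. J. Math. 103 (1981), §1, Prop. (3.17) [JacquetShalikaAJM1981].
-/

noncomputable section

open Filter MeasureTheory Measure NumberField IsDedekindDomain
open scoped MatrixGroups Topology InnerProductSpace

namespace Literature.NumberTheory.Automorphic

/-! ### Elementary elements of `SL₂(F)` and `GL₂(F)` -/

namespace SL2Mautner

variable {F : Type*} [Field F]

/-- The upper unipotent `n(x) = (1 x; 0 1) ∈ SL₂(F)`. [folklore] -/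
abbrev upper (x : F) : SL(2, F) := Matrix.SpecialLinearGroup.transvection (show (0 : Fin 2) ≠ 1 by decide) x

/-- The lower unipotent `n̄(x) = (1 0; x 1) ∈ SL₂(F)`. [folklore] -/
abbrev lower (x : F) : SL(2, F) := Matrix.SpecialLinearGroup.transvection (show (1 : Fin 2) ≠ 0 by decide) x

/-- The split torus `t ↦ diag(t, t⁻¹)` of `SL₂(F)`. [folklore] -/
def torus : Fˣ →* SL(2, F) where
  toFun t := ⟨!![(t : F), 0; 0, ((t⁻¹ : Fˣ) : F)], by
    rw [Matrix.det_fin_two_of]; simp⟩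
  map_one' := by
    refine Subtype.ext ?_
    ext i j
    fin_cases i <;> fin_cases j <;> simp
  map_mul' s t := by
    refine Subtype.ext ?_
    change !![((s * t : Fˣ) : F), 0; 0, (((s * t)⁻¹ : Fˣ) : F)] =
      !![(s : F), 0; 0, ((s⁻¹ : Fˣ) : F)] * !![(t : F), 0; 0, ((t⁻¹ : Fˣ) : F)]
    rw [mul_inv, Units.val_mul, Units.val_mul]
    ext i j
    fin_cases i <;> fin_cases j <;> simp [Matrix.mul_apply, Fin.sum_univ_two, mul_comm]

/-- The matrix of `torus t`. [folklore] -/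
theorem coe_torus (t : Fˣ) : ((torus t : SL(2, F)) : Matrix (Fin 2) (Fin 2) F) =
    !![(t : F), 0; 0, ((t⁻¹ : Fˣ) : F)] := rfl

/-- The Weyl element `w = (0 -1; 1 0) ∈ SL₂(F)`. [folklore] -/
def weyl : SL(2, F) := ⟨!![0, -1; 1, 0], by rw [Matrix.det_fin_two_of]; ring⟩

/-- The matrix of `weyl`. [folklore] -/
theorem coe_weyl : ((weyl : SL(2, F)) : Matrix (Fin 2) (Fin 2) F) = !![0, -1; 1, 0] := rfl

/-- The matrix of `weyl⁻¹` is `(0 1; -1 0)`. [folklore] -/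
theorem coe_weyl_inv : ((weyl⁻¹ : SL(2, F)) : Matrix (Fin 2) (Fin 2) F) = !![0, 1; -1, 0] := by
  rw [Matrix.SpecialLinearGroup.coe_inv, coe_weyl]
  ext i j
  fin_cases i <;> fin_cases j <;> simp [Matrix.adjugate_fin_two]

/-- The matrix of `upper x`. [folklore] -/
theorem coe_upper (x : F) : ((upper x : SL(2, F)) : Matrix (Fin 2) (Fin 2) F) = !![1, x; 0, 1] := by
  rw [Matrix.SpecialLinearGroup.transvection_coe]
  ext i j
  fin_cases i <;> fin_cases j <;> simp

/-- The matrix of `lower x`. [folklore] -/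
theorem coe_lower (x : F) : ((lower x : SL(2, F)) : Matrix (Fin 2) (Fin 2) F) = !![1, 0; x, 1] := by
  rw [Matrix.SpecialLinearGroup.transvection_coe]
  ext i j
  fin_cases i <;> fin_cases j <;> simp

/-- **The Bruhat relation for an upper unipotent**:
`n(s) = n̄(s⁻¹) · diag(s, s⁻¹) · w⁻¹ · n̄(s⁻¹)` for a unit `s`. [folklore] -/
theorem upper_eq_lower_mul_torus_mul_weyl_inv_mul_lower (s : Fˣ) :
    upper (s : F) = lower ((s⁻¹ : Fˣ) : F) * torus s * weyl⁻¹ * lower ((s⁻¹ : Fˣ) : F) := by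
  refine Subtype.ext ?_
  rw [Matrix.SpecialLinearGroup.coe_mul, Matrix.SpecialLinearGroup.coe_mul,
    Matrix.SpecialLinearGroup.coe_mul, coe_upper, coe_lower, coe_torus, coe_weyl_inv, Units.val_inv_eq_inv_val]
  have hs : (s : F) ≠ 0 := s.ne_zero
  ext i j
  fin_cases i <;> fin_cases j <;> simp [Matrix.mul_apply, Fin.sum_univ_two]

/-- `w · diag(t⁻¹, t) · w⁻¹ = diag(t, t⁻¹)`. [folklore] -/
theorem weyl_mul_torus_inv_mul_weyl_inv (t : Fˣ) : weyl * torus t⁻¹ * weyl⁻¹ = (torus t : SL(2, F)) := by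
  refine Subtype.ext ?_
  rw [Matrix.SpecialLinearGroup.coe_mul, Matrix.SpecialLinearGroup.coe_mul, coe_torus, coe_torus, coe_weyl,
    coe_weyl_inv, inv_inv]
  ext i j
  fin_cases i <;> fin_cases j <;> simp [Matrix.mul_apply, Fin.sum_univ_two]

/-- **`SL₂` of a field is generated by the elementary unipotents**: a subgroup containing all `n(x)`
and all `n̄(x)` is everything (Whitehead's lemma, `Matrix.SpecialLinearGroup.mem_of_isUnit_apply`:
either `g₀₀ ≠ 0`, or `g₁₀ ≠ 0` and `g₀₀ + 1 · g₁₀` is a unit). [folklore] -/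
theorem subgroup_eq_top_of_forall_upper_lower (H : Subgroup SL(2, F)) (hu : ∀ x : F, upper x ∈ H)
    (hl : ∀ x : F, lower x ∈ H) : H = ⊤ := by
  refine (Subgroup.eq_top_iff' H).2 fun g => ?_
  by_cases h0 : g 0 0 = 0
  · have hdet : g 0 0 * g 1 1 - g 0 1 * g 1 0 = 1 := by
      have := g.2
      rw [Matrix.det_fin_two] at this
      exact this
    have h10 : g 1 0 ≠ 0 := by
      intro h
      rw [h0, h, zero_mul, mul_zero, sub_zero] at hdet
      exact zero_ne_one hdet
    exact Matrix.SpecialLinearGroup.mem_of_isUnit_apply_add_mul H hu hl g (t := 1)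
      (by rw [h0, zero_add, one_mul]; exact isUnit_iff_ne_zero.2 h10)
  · exact Matrix.SpecialLinearGroup.mem_of_isUnit_apply H hu hl g (isUnit_iff_ne_zero.2 h0)

/-- The diagonal element `d(t) = diag(t, 1) ∈ GL₂(F)` of the mirabolic torus. [folklore] -/
def diagOne (t : Fˣ) : GL (Fin 2) F :=
  ⟨!![(t : F), 0; 0, 1], !![((t⁻¹ : Fˣ) : F), 0; 0, 1],
    by ext i j; fin_cases i <;> fin_cases j <;> simp [Matrix.mul_apply, Fin.sum_univ_two],
    by ext i j; fin_cases i <;> fin_cases j <;> simp [Matrix.mul_apply, Fin.sum_univ_two]⟩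

/-- The matrix of `diagOne t`. [folklore] -/
theorem coe_diagOne (t : Fˣ) : ((diagOne t : GL (Fin 2) F) : Matrix (Fin 2) (Fin 2) F) = !![(t : F), 0; 0, 1] := rfl

/-- **`d(t)` contracts the lower unipotents as `t → 0`**: `d(t)⁻¹ · n̄(x) · d(t) = n̄(t x)`. [folklore] -/
theorem diagOne_inv_mul_lower_mul_diagOne (t : Fˣ) (x : F) :
    (diagOne t)⁻¹ * Matrix.SpecialLinearGroup.toGL (lower x) * diagOne t =
      Matrix.SpecialLinearGroup.toGL (lower ((t : F) * x)) := by
  refine Units.ext ?_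
  rw [Units.val_mul, Units.val_mul]
  change ((diagOne t)⁻¹ : GL (Fin 2) F).val * ((lower x : SL(2, F)) : Matrix (Fin 2) (Fin 2) F) * (diagOne t).val =
    ((lower ((t : F) * x) : SL(2, F)) : Matrix (Fin 2) (Fin 2) F)
  have hinv : ((diagOne t)⁻¹ : GL (Fin 2) F).val = !![((t⁻¹ : Fˣ) : F), 0; 0, 1] := rfl
  rw [hinv, coe_lower, coe_lower]
  change _ * !![(t : F), 0; 0, 1] = _
  ext i j
  fin_cases i <;> fin_cases j <;> simp [Matrix.mul_apply, Fin.sum_univ_two, mul_comm]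

/-- Conjugating an element of `SL₂(F)` by an element of `GL₂(F)` inside `GL₂(F)` gives an element of
`SL₂(F)`. [folklore] -/
def conjSL (g : GL (Fin 2) F) (s : SL(2, F)) : SL(2, F) :=
  ⟨(g⁻¹ : GL (Fin 2) F).val * (s : Matrix (Fin 2) (Fin 2) F) * g.val, by
    rw [Matrix.det_mul, Matrix.det_mul, s.2, mul_one, ← Matrix.det_mul, ← Units.val_mul, inv_mul_cancel,
      Units.val_one, Matrix.det_one]⟩

/-- `g⁻¹ s g = conjSL g s` in `GL₂(F)`. [folklore] -/
theorem toGL_conjSL (g : GL (Fin 2) F) (s : SL(2, F)) :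
    Matrix.SpecialLinearGroup.toGL (conjSL g s) = g⁻¹ * Matrix.SpecialLinearGroup.toGL s * g :=
  Units.ext rfl

end SL2Mautner

/-! ### Two lemmas: weak convergence from a total set; units accumulate at `0` -/

section Hilbert

variable {H : Type*} [NormedAddCommGroup H] [InnerProductSpace ℂ H] [CompleteSpace H]

/-- **Weak convergence to `0` from a total set.** Let `f : ι → H` be bounded along a filter `L`
(`‖f i‖ ≤ C`) in a Hilbert space and `Y ⊆ H` a set of vectors such that `⟪f i, y⟫ → 0` along `L` for
every `y ∈ Y`; if `Y` is total — the only vector orthogonal to `Y` is `0` — then `⟪f i, w⟫ → 0` for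
EVERY `w ∈ H` (the span of `Y` is dense and the inner products are equicontinuous in `w`).
[folklore] -/
theorem tendsto_inner_zero_of_forall_mem {ι : Type*} {L : Filter ι} {f : ι → H} {C : ℝ}
    (hC : ∀ i, ‖f i‖ ≤ C) {Y : Set H}
    (hY : ∀ y ∈ Y, Tendsto (fun i => ⟪f i, y⟫_ℂ) L (𝓝 0))
    (htot : ∀ u : H, (∀ y ∈ Y, ⟪y, u⟫_ℂ = 0) → u = 0) (w : H) :
    Tendsto (fun i => ⟪f i, w⟫_ℂ) L (𝓝 0) := by
  -- the span of `Y` is dense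
  set S : Submodule ℂ H := Submodule.span ℂ Y with hS
  have hSorth : Sᗮ = ⊥ := by
    rw [Submodule.eq_bot_iff]
    intro u hu
    refine htot u fun y hy => ?_
    exact (Submodule.mem_orthogonal S u).1 hu y (Submodule.subset_span hy)
  have hdense : S.topologicalClosure = ⊤ := Submodule.topologicalClosure_eq_top_iff.2 hSorth
  -- the convergence on the span
  have hspan : ∀ y ∈ S, Tendsto (fun i => ⟪f i, y⟫_ℂ) L (𝓝 0) := by
    intro y hy
    induction hy using Submodule.span_induction with
    | mem y hy => exact hY y hy
    | zero => simpa only [inner_zero_right] using tendsto_const_nhds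
    | add y z _ _ hy hz =>
      simpa only [inner_add_right, add_zero] using hy.add hz
    | smul c y _ hy =>
      simpa only [inner_smul_right, mul_zero] using hy.const_mul c
  -- `C ≥ 0` unless the index type is empty along `L`
  rw [Metric.tendsto_nhds]
  intro ε hε
  have hC0 : 0 ≤ max C 0 := le_max_right _ _
  -- approximate `w` by `y ∈ S`
  have hw : w ∈ closure (S : Set H) := by
    rw [← Submodule.topologicalClosure_coe, hdense]
    trivial
  rw [Metric.mem_closure_iff] at hw
  obtain ⟨y, hyS, hyw⟩ := hw (ε / (2 * (max C 0 + 1))) (by positivity)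
  have hy := (Metric.tendsto_nhds.1 (hspan y hyS)) (ε / 2) (half_pos hε)
  filter_upwards [hy] with i hi
  rw [dist_zero_right] at hi ⊢
  have h1 : ⟪f i, w⟫_ℂ = ⟪f i, y⟫_ℂ + ⟪f i, w - y⟫_ℂ := by
    rw [← inner_add_right, add_sub_cancel]
  rw [h1]
  refine lt_of_le_of_lt (norm_add_le _ _) ?_
  have h2 : ‖⟪f i, w - y⟫_ℂ‖ ≤ max C 0 * (ε / (2 * (max C 0 + 1))) := by
    refine (norm_inner_le_norm _ _).trans ?_
    refine mul_le_mul ((hC i).trans (le_max_left _ _)) ?_ (norm_nonneg _) hC0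
    rw [← dist_eq_norm]
    exact hyw.le
  have h3 : max C 0 * (ε / (2 * (max C 0 + 1))) < ε / 2 := by
    rw [mul_div_assoc', div_lt_div_iff₀ (by positivity) (by positivity)]
    nlinarith [hC0, hε]
  linarith [h2, h3]

end Hilbert

section LocalField

open IsDedekindDomain

variable {R : Type*} [CommRing R] [IsDedekindDomain R] {K : Type*} [Field K] [Algebra R K]
  [IsFractionRing R K] (v : HeightOneSpectrum R)

/-- **The units of a completion `K_v` accumulate at `0`**: the filter `comap ((↑) : K_vˣ → K_v) (𝓝 0)`
of units tending to `0` is non-trivial (powers of a uniformizer are units of arbitrarily small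
valuation). [folklore] -/
theorem neBot_comap_units_val_nhds_zero_adicCompletion :
    (comap ((↑) : (v.adicCompletion K)ˣ → v.adicCompletion K) (𝓝 0)).NeBot := by
  obtain ⟨π, hπ⟩ := v.valuation_exists_uniformizer K
  set ϖ : v.adicCompletion K := (π : v.adicCompletion K) with hϖ
  have hϖv : Valued.v ϖ = WithZero.exp (-1 : ℤ) := by
    rw [hϖ, HeightOneSpectrum.valuedAdicCompletion_eq_valuation', hπ]
  have hϖ0 : ϖ ≠ 0 := by
    intro h
    rw [h, map_zero] at hϖv
    exact WithZero.zero_ne_coe hϖv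
  have hlt : Valued.v ϖ < 1 := by
    rw [hϖv, ← WithZero.exp_zero, WithZero.exp_lt_exp]
    norm_num
  have hpow : Tendsto (fun k : ℕ => ϖ ^ k) atTop (𝓝 0) := Valued.tendsto_zero_pow_of_v_lt_one hlt
  refine comap_neBot fun t ht => ?_
  obtain ⟨k, hk⟩ := (hpow.eventually ht).exists
  exact ⟨Units.mk0 (ϖ ^ k) (pow_ne_zero k hϖ0), hk⟩

end LocalField

/-! ### Mautner at one finite place for the regular representation of `GL₂(𝔸_K)` -/

section Cuspidal

variable {K : Type} [Field K] [NumberField K]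
  {μ : Measure (AdelicGroupData.gl 2 K).automorphicQuotient}
  [(AdelicGroupData.gl 2 K).IsAutomorphicMeasure μ]
  (v : HeightOneSpectrum (𝓞 K))

attribute [local instance] adelicBorel borelSpace_adelic locallyCompactSpace_adelic
  secondCountableTopology_gl_adelic glAdeleBorel borelSpace_glAdele

/-- The local embedding `SL₂(K_v) →* GL₂(𝔸_K)` (`GLn.toAdelic ∘ toGL`). [folklore] -/
abbrev slToAdelic : SL(2, v.adicCompletion K) →* (AdelicGroupData.gl 2 K).Adelic :=
  (GLn.toAdelic 2 K v).comp Matrix.SpecialLinearGroup.toGL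

/-- Each operator of the regular representation is an isometry. [folklore] -/
theorem norm_rightRegular_apply' (g : (AdelicGroupData.gl 2 K).Adelic) (x : (AdelicGroupData.gl 2 K).L2 μ) :
    ‖(AdelicGroupData.gl 2 K).rightRegular μ g x‖ = ‖x‖ :=
  (AdelicGroupData.gl 2 K).norm_rightRegular_apply μ g x

/-- `x ↦ R(ι_v(n(x))) u` and `x ↦ R(ι_v(n̄(x))) u` are continuous (strong continuity of `R`,
continuity of the local embedding and of the transvections). [folklore] -/
theorem continuous_rightRegular_slToAdelic_transvection {i j : Fin 2} (hij : i ≠ j)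
    (u : (AdelicGroupData.gl 2 K).L2 μ) :
    Continuous fun x : v.adicCompletion K =>
      (AdelicGroupData.gl 2 K).rightRegular μ
        (slToAdelic v (Matrix.SpecialLinearGroup.transvection hij x)) u := by
  have hR := (AdelicGroupData.isStronglyContinuous_rightRegular_holds (AdelicGroupData.gl 2 K) μ) u
  refine hR.comp ?_
  exact (GLn.continuous_toAdelic 2 K v).comp
    (Matrix.SpecialLinearGroup.continuous_toGL.comp (Matrix.SpecialLinearGroup.continuous_transvection hij))

/-- **Mautner at `v` for the regular representation of `GL₂(𝔸_K)`.** An `L²` automorphic form `u`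
fixed by all lower unipotents `ι_v(n̄(x))`, `x ∈ K_v`, of one finite place `v` is fixed by
`ι_v(SL₂(K_v))`: Mautner's lemma (`Literature.RepresentationTheory.mautner_torus`, `mautner_weyl`,
`mautner_lower`, with the families `(n̄, n, diag(·⁻¹, ·), w⁻¹)` and the relations
`upper_eq_lower_mul_torus_mul_weyl_inv_mul_lower`, `weyl_mul_torus_inv_mul_weyl_inv`) gives the
invariance under `n(x)`, and `n`, `n̄` generate `SL₂(K_v)`.
[cite: Mautner1957, §1] [cite: EinsiedlerWard2017, Prop. 10.41 (pp. 415–417)] -/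
theorem rightRegular_slToAdelic_apply_eq_of_forall_lower {u : (AdelicGroupData.gl 2 K).L2 μ}
    (h : ∀ x : v.adicCompletion K, (AdelicGroupData.gl 2 K).rightRegular μ (slToAdelic v (SL2Mautner.lower x)) u = u)
    (g : SL(2, v.adicCompletion K)) :
    (AdelicGroupData.gl 2 K).rightRegular μ (slToAdelic v g) u = u := by
  haveI := neBot_comap_units_val_nhds_zero_adicCompletion (K := K) v
  set R := (AdelicGroupData.gl 2 K).rightRegular μ with hRdef
  set ι := slToAdelic (K := K) v with hι
  -- the four families of the abstract lemma: `u ↦ n̄`, `l ↦ n`, `a ↦ diag(t⁻¹, t)`, `w ↦ w⁻¹`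
  set uF : (v.adicCompletion K)ˣ → (AdelicGroupData.gl 2 K).Adelic := fun x => ι (SL2Mautner.lower (x : v.adicCompletion K))
  set lF : (v.adicCompletion K)ˣ → (AdelicGroupData.gl 2 K).Adelic := fun s => ι (SL2Mautner.upper (s : v.adicCompletion K))
  set aF : (v.adicCompletion K)ˣ →* (AdelicGroupData.gl 2 K).Adelic := ι.comp (SL2Mautner.torus.comp invMonoidHom)
  set wF : (AdelicGroupData.gl 2 K).Adelic := ι SL2Mautner.weyl⁻¹
  have haF : ∀ t, aF t = ι (SL2Mautner.torus t⁻¹) := fun t => rfl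
  have hrel : ∀ s, lF s = uF s⁻¹ * aF s⁻¹ * wF * uF s⁻¹ := by
    intro s
    change ι _ = ι _ * aF s⁻¹ * ι _ * ι _
    rw [haF, inv_inv, SL2Mautner.upper_eq_lower_mul_torus_mul_weyl_inv_mul_lower s, map_mul, map_mul, map_mul]
  have hw : ∀ t, wF⁻¹ * aF t * wF = aF t⁻¹ := by
    intro t
    rw [haF, haF, inv_inv]
    change (ι _)⁻¹ * ι _ * ι _ = ι _
    rw [← map_inv, inv_inv, ← map_mul, ← map_mul, SL2Mautner.weyl_mul_torus_inv_mul_weyl_inv]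
  have hu : ∀ x : (v.adicCompletion K)ˣ, R (uF x) u = u := fun x => h x
  have hl : Tendsto (fun s : (v.adicCompletion K)ˣ => R (lF s) u) (comap ((↑) : _ → v.adicCompletion K) (𝓝 0)) (𝓝 u) := by
    have hc := continuous_rightRegular_slToAdelic_transvection (μ := μ) v (show (0 : Fin 2) ≠ 1 by decide) u
    have h0 := hc.tendsto 0
    simp only [Matrix.SpecialLinearGroup.transvection_coeff_zero, map_one, one_apply_eq_self] at h0
    exact h0.comp tendsto_comap
  have hiso : ∀ (g : (AdelicGroupData.gl 2 K).Adelic) (x : (AdelicGroupData.gl 2 K).L2 μ), ‖R g x‖ = ‖x‖ :=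
    norm_rightRegular_apply'
  have hupper : ∀ s : (v.adicCompletion K)ˣ, R (lF s) u = u :=
    Literature.RepresentationTheory.mautner_lower R hiso uF lF aF wF hrel hw hu hl
  -- the stabiliser contains all elementary unipotents
  set H : Subgroup SL(2, v.adicCompletion K) :=
    { carrier := {g | R (ι g) u = u}
      mul_mem' := fun {a b} ha hb => by
        change R (ι (a * b)) u = u
        rw [map_mul, map_mul, mul_apply_eq_comp, hb, ha]
      one_mem' := by
        change R (ι 1) u = u
        rw [map_one, map_one, one_apply_eq_self]
      inv_mem' := fun {a} ha => by
        change R (ι a⁻¹) u = u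
        have h1 : R (ι a⁻¹) (R (ι a) u) = u := by
          rw [← mul_apply_eq_comp, ← map_mul, ← map_mul, inv_mul_cancel, map_one, map_one,
            one_apply_eq_self]
        rwa [ha] at h1 } with hH
  have hupper' : ∀ x : v.adicCompletion K, SL2Mautner.upper x ∈ H := by
    intro x
    by_cases hx : x = 0
    · subst hx
      change R (ι (Matrix.SpecialLinearGroup.transvection _ 0)) u = u
      rw [Matrix.SpecialLinearGroup.transvection_coeff_zero, map_one, map_one, one_apply_eq_self]
    · exact hupper (Units.mk0 x hx)
  have hlower' : ∀ x : v.adicCompletion K, SL2Mautner.lower x ∈ H := fun x => h x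
  have htop : H = ⊤ := SL2Mautner.subgroup_eq_top_of_forall_upper_lower H hupper' hlower'
  have hg : g ∈ H := by rw [htop]; exact Subgroup.mem_top g
  exact hg

/-- **Conjugation into `ι_v(SL₂(K_v))`**: for `g ∈ GL₂(𝔸_K)` and `s ∈ SL₂(K_v)`,
`g⁻¹ ι_v(s) g = ι_v(g_v⁻¹ s g_v)` (`g = g^{(v)} ι_v(g_v)` with `g^{(v)}` commuting with `ι_v`,
`GLn.awayFrom_mul_toAdelic`, `GLn.toAdelic_mul_awayFrom`). [folklore] -/
theorem inv_mul_slToAdelic_mul (g : (AdelicGroupData.gl 2 K).Adelic) (s : SL(2, v.adicCompletion K)) :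
    g⁻¹ * slToAdelic v s * g = slToAdelic v (SL2Mautner.conjSL (GLn.toLocalAt 2 K v g) s) := by
  change g⁻¹ * GLn.toAdelic 2 K v (Matrix.SpecialLinearGroup.toGL s) * g =
    GLn.toAdelic 2 K v (Matrix.SpecialLinearGroup.toGL (SL2Mautner.conjSL (GLn.toLocalAt 2 K v g) s))
  rw [SL2Mautner.toGL_conjSL, map_mul, map_mul, map_inv]
  set gv := GLn.toLocalAt 2 K v g with hgv
  set A := GLn.awayFrom 2 K v g with hA
  set B := GLn.toAdelic 2 K v gv with hB
  set S := GLn.toAdelic 2 K v (Matrix.SpecialLinearGroup.toGL s) with hS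
  have hg : g = A * B := (GLn.awayFrom_mul_toAdelic g).symm
  have hSA : S * A = A * S := GLn.toAdelic_mul_awayFrom _ g
  rw [hg, _root_.mul_inv_rev,
    show B⁻¹ * A⁻¹ * S * (A * B) = B⁻¹ * (A⁻¹ * (S * A)) * B by simp only [mul_assoc], hSA,
    inv_mul_cancel_left]

/-- The same in the form `ι_v(s) g = g ι_v(g_v⁻¹ s g_v)`. [folklore] -/
theorem slToAdelic_mul_eq (g : (AdelicGroupData.gl 2 K).Adelic) (s : SL(2, v.adicCompletion K)) :
    slToAdelic v s * g = g * slToAdelic v (SL2Mautner.conjSL (GLn.toLocalAt 2 K v g) s) := by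
  rw [← inv_mul_slToAdelic_mul, ← mul_assoc, ← mul_assoc, mul_inv_cancel, one_mul]

/-- `ι_v(n(y))` lies in `N₂(𝔸_K)`. [folklore] -/
theorem slToAdelic_upper_mem_adelicUnipotent (y : v.adicCompletion K) :
    slToAdelic v (SL2Mautner.upper y) ∈ adelicUnipotent 2 K := by
  change GLn.ofLocal 2 K v (Matrix.SpecialLinearGroup.toGL (SL2Mautner.upper y)) ∈ adelicUnipotent 2 K
  refine ofLocal_mem_adelicUnipotent ?_
  rw [mem_upperUnitriangular_iff]
  refine ⟨?_, ?_⟩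
  · intro i j hij
    change ((SL2Mautner.upper y : SL(2, v.adicCompletion K)) : Matrix (Fin 2) (Fin 2) (v.adicCompletion K)) i j = 0
    rw [SL2Mautner.coe_upper]
    fin_cases i <;> fin_cases j <;> simp at hij ⊢
  · intro i
    change ((SL2Mautner.upper y : SL(2, v.adicCompletion K)) : Matrix (Fin 2) (Fin 2) (v.adicCompletion K)) i i = 1
    rw [SL2Mautner.coe_upper]
    fin_cases i <;> simp

/-- `n(y) ∈ U₂(K_v)`. [folklore] -/
theorem toGL_upper_mem_upperUnitriangular (y : v.adicCompletion K) :
    Matrix.SpecialLinearGroup.toGL (SL2Mautner.upper y) ∈ upperUnitriangular (Fin 2) (v.adicCompletion K) := by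
  rw [mem_upperUnitriangular_iff]
  refine ⟨?_, ?_⟩
  · intro i j hij
    change ((SL2Mautner.upper y : SL(2, v.adicCompletion K)) : Matrix (Fin 2) (Fin 2) (v.adicCompletion K)) i j = 0
    rw [SL2Mautner.coe_upper]
    fin_cases i <;> fin_cases j <;> simp at hij ⊢
  · intro i
    change ((SL2Mautner.upper y : SL(2, v.adicCompletion K)) : Matrix (Fin 2) (Fin 2) (v.adicCompletion K)) i i = 1
    rw [SL2Mautner.coe_upper]
    fin_cases i <;> simp

/-- **The generic character at `ι_v(n(y))` is `ψ_v(y)`.** [folklore] -/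
theorem whittakerCharFun_slToAdelic_upper (ψ : AddChar (AdeleRing (𝓞 K) K) Circle) (y : v.adicCompletion K) :
    whittakerCharFun ψ ⟨slToAdelic v (SL2Mautner.upper y), slToAdelic_upper_mem_adelicUnipotent v y⟩ =
      ψ.adicComponent v y := by
  have h := whittakerCharFun_ofLocal (n := 2) ψ
    ⟨Matrix.SpecialLinearGroup.toGL (SL2Mautner.upper y), toGL_upper_mem_upperUnitriangular v y⟩
  have h' : whittakerCharFun ψ ⟨slToAdelic v (SL2Mautner.upper y), slToAdelic_upper_mem_adelicUnipotent v y⟩ =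
      whittakerCharFun (ψ.adicComponent v)
        ⟨Matrix.SpecialLinearGroup.toGL (SL2Mautner.upper y), toGL_upper_mem_upperUnitriangular v y⟩ := h
  rw [h', whittakerCharFun_apply, superdiagSum_def]
  congr 1
  simp [Fin.sum_univ_two, Matrix.SpecialLinearGroup.coe_GL_coe_matrix, SL2Mautner.coe_upper]

set_option quotPrecheck false in
/-- The regular representation of `GL₂(𝔸_K)` on `L²` (local notation). -/
local notation "R₂" => AdelicGroupData.rightRegular (AdelicGroupData.gl 2 K) μ

/-- The inverse on one side of an inner product: `⟪a, R(l⁻¹) y⟫ = ⟪R(l) a, y⟫` (unitarity). [folklore] -/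
theorem inner_rightRegular_inv_right (l : (AdelicGroupData.gl 2 K).Adelic) (a y : (AdelicGroupData.gl 2 K).L2 μ) :
    ⟪a, R₂ l⁻¹ y⟫_ℂ = ⟪R₂ l a, y⟫_ℂ := by
  have hunit : ContRepresentation.IsUnitary R₂ := (AdelicGroupData.gl 2 K).isUnitary_rightRegular μ
  rw [← hunit.adjoint_apply l, ContinuousLinearMap.adjoint_inner_right]


/-- **A cuspidal automorphic representation of `GL₂(𝔸_K)` has no non-zero `N̄(K_v)`-invariant vector**
(the input of Howe–Moore's theorem for the action of `GL₂(K_v)` on `Π`, proved here from Mautner's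
lemma and the genericity of cusp forms): if `u ∈ Π` is fixed by all `R(ι_v(n̄(x)))`, `x ∈ K_v`, then
`u = 0`. Proof: `u` is `ι_v(SL₂(K_v))`-invariant (`rightRegular_slToAdelic_apply_eq_of_forall_lower`);
the `ι_v(SL₂(K_v))`-invariant vectors of `Π` form a closed subspace which is `GL₂(𝔸_K)`-invariant
because `g⁻¹ ι_v(s) g = ι_v(g_v⁻¹ s g_v)` (`inv_mul_slToAdelic_mul`); were it non-zero it would be all
of `Π` (irreducibility, `isTopIrreducible_toContRep_iff`), in particular the smoothed test vector
`S_η f ≠ 0` of `CuspidalTestVector` would be invariant, its continuous representative would satisfy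
`S_η f (ι_v(s)⁻¹ • x) = S_η f (x)` everywhere (`μ` is positive on open sets), so the Whittaker
coefficient `W` of `invQuot (S_η f)` would satisfy `W(g ι_v(s)) = W(g)` and hence
`ψ_v(y) W(g) = W(ι_v(n(y)) g) = W(g ι_v(g_v⁻¹ n(y) g_v)) = W(g)`; as `ψ_v ≠ 1`
(`adicComponent_adeleAddChar_ne_one`) `W ≡ 0`, contradicting
`exists_whittakerCoeff_invQuot_smoothedForm_ne_zero_of_one_le`. (Howe–Moore (1979), Thms. 5.1–5.2, give the
decay of all matrix coefficients of `GL₂(K_v)` on `Π`; this is the part of it used below.)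
[cite: HoweMoore1979, Thm. 5.1 and Thm. 5.2] -/
theorem CuspidalAutomorphicRepGL.eq_zero_of_forall_lower_apply_eq (P : CuspidalAutomorphicRepGL 2 K μ)
    {u : (AdelicGroupData.gl 2 K).L2 μ} (huP : u ∈ P.1)
    (h : ∀ x : v.adicCompletion K, R₂ (slToAdelic v (SL2Mautner.lower x)) u = u) :
    u = 0 := by
  classical
  by_contra hu0
  have hall : ∀ g : SL(2, v.adicCompletion K), R₂ (slToAdelic v g) u = u :=
    rightRegular_slToAdelic_apply_eq_of_forall_lower v h
  -- the closed invariant subspace of the `ι_v(SL₂(K_v))`-invariant vectors of `Π`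
  let Sfix : ContRepresentation.ClosedSubrep R₂ :=
    { toSubmodule :=
        { carrier := {f | f ∈ P.1 ∧ ∀ g : SL(2, v.adicCompletion K), R₂ (slToAdelic v g) f = f}
          add_mem' := fun {a b} ha hb => ⟨P.1.toSubmodule.add_mem ha.1 hb.1, fun g => by
            rw [map_add, ha.2 g, hb.2 g]⟩
          zero_mem' := ⟨P.1.toSubmodule.zero_mem, fun g => by rw [map_zero]⟩
          smul_mem' := fun c a ha => ⟨P.1.toSubmodule.smul_mem c ha.1, fun g => by
            rw [map_smul, ha.2 g]⟩ }
      apply_mem_toSubmodule := fun g' f hf => by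
        refine ⟨P.1.apply_mem g' hf.1, fun s => ?_⟩
        change R₂ (slToAdelic v s) (R₂ g' f) = R₂ g' f
        rw [← mul_apply_eq_comp, ← map_mul, slToAdelic_mul_eq v g' s, map_mul, mul_apply_eq_comp, hf.2]
      isClosed' := by
        have heq : ({f | f ∈ P.1 ∧ ∀ g : SL(2, v.adicCompletion K), R₂ (slToAdelic v g) f = f} :
            Set ((AdelicGroupData.gl 2 K).L2 μ)) =
            (P.1 : Set ((AdelicGroupData.gl 2 K).L2 μ)) ∩
              ⋂ g : SL(2, v.adicCompletion K), {f | R₂ (slToAdelic v g) f - f = 0} := by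
          ext f
          simp only [Set.mem_setOf_eq, Set.mem_inter_iff, Set.mem_iInter, sub_eq_zero, SetLike.mem_coe]
        change IsClosed ({f | f ∈ P.1 ∧ ∀ g : SL(2, v.adicCompletion K), R₂ (slToAdelic v g) f = f} :
            Set ((AdelicGroupData.gl 2 K).L2 μ))
        rw [heq]
        exact P.1.isClosed.inter (isClosed_iInter fun g =>
          isClosed_eq ((R₂ (slToAdelic v g)).continuous.sub continuous_id) continuous_const) }
  have hle : Sfix ≤ P.1 := fun f hf => hf.1
  have hmem : u ∈ Sfix := ⟨huP, hall⟩
  have hne_bot : Sfix ≠ ⊥ := by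
    intro hbot
    have h0 : u ∈ (⊥ : ContRepresentation.ClosedSubrep R₂) := hbot ▸ hmem
    rw [ContRepresentation.ClosedSubrep.mem_bot] at h0
    exact hu0 h0
  have htop : Sfix = P.1 :=
    (((ContRepresentation.ClosedSubrep.isTopIrreducible_toContRep_iff P.1).1 P.isTopIrreducible).2
      Sfix hle).resolve_left hne_bot
  have hfix : ∀ f ∈ P.1, ∀ g : SL(2, v.adicCompletion K), R₂ (slToAdelic v g) f = f := by
    intro f hf g
    have hf' : f ∈ Sfix := by rw [htop]; exact hf
    exact hf'.2 g
  -- the smoothed test vector and its continuous representative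
  obtain ⟨f₀, η, hη, -, hne, -⟩ := P.exists_isTestFunctionGL_smoothedForm_ne_zero
  have hηc : Continuous η := hη.continuous
  have hηs : HasCompactSupport η := hη.hasCompactSupport
  have hF₀c : Continuous (smoothedForm η ((f₀ : P.1.toSubmodule) : (AdelicGroupData.gl 2 K).L2 μ)) :=
    continuous_smoothedForm hηc hηs _
  have hsvae := smoothedVector_ae_eq P.1 hηc hηs f₀
  -- `S_η f₀` is invariant under `ι_v(SL₂(K_v))` at EVERY point
  have hinv : ∀ (s : SL(2, v.adicCompletion K)) (x : (AdelicGroupData.gl 2 K).automorphicQuotient),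
      smoothedForm η ((f₀ : P.1.toSubmodule) : (AdelicGroupData.gl 2 K).L2 μ) ((slToAdelic v s)⁻¹ • x) =
        smoothedForm η ((f₀ : P.1.toSubmodule) : (AdelicGroupData.gl 2 K).L2 μ) x := by
    intro s
    have h1 := (AdelicGroupData.gl 2 K).rightRegular_apply_coeFn μ (slToAdelic v s)
      ((smoothedVector P.1 η f₀ : P.1.toSubmodule) : (AdelicGroupData.gl 2 K).L2 μ)
    rw [hfix _ (smoothedVector P.1 η f₀).2 s] at h1
    have h2 := ae_eq_comp_smul hsvae (slToAdelic v s)⁻¹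
    have h3 : (fun x => smoothedForm η ((f₀ : P.1.toSubmodule) : (AdelicGroupData.gl 2 K).L2 μ)
        ((slToAdelic v s)⁻¹ • x)) =ᵐ[μ]
        smoothedForm η ((f₀ : P.1.toSubmodule) : (AdelicGroupData.gl 2 K).L2 μ) :=
      (h2.symm.trans h1.symm).trans hsvae
    have hc1 : Continuous fun x => smoothedForm η ((f₀ : P.1.toSubmodule) : (AdelicGroupData.gl 2 K).L2 μ)
        ((slToAdelic v s)⁻¹ • x) := hF₀c.comp (continuous_const_smul _)
    exact fun x => congrFun ((Continuous.ae_eq_iff_eq μ hc1 hF₀c).1 h3) x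
  -- the classical function `φ₀ = invQuot (S_η f₀)` is right `ι_v(SL₂(K_v))`-invariant
  have hφ₀inv : ∀ (s : SL(2, v.adicCompletion K)) (g : (AdelicGroupData.gl 2 K).Adelic),
      invQuot (AdelicGroupData.gl 2 K)
          (smoothedForm η ((f₀ : P.1.toSubmodule) : (AdelicGroupData.gl 2 K).L2 μ)) (g * slToAdelic v s) =
        invQuot (AdelicGroupData.gl 2 K)
          (smoothedForm η ((f₀ : P.1.toSubmodule) : (AdelicGroupData.gl 2 K).L2 μ)) g := by
    intro s g
    rw [invQuot_apply, invQuot_apply, _root_.mul_inv_rev, ← AdelicGroupData.smul_toAutomorphicQuotient]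
    exact hinv s _
  -- topological and measurable structures on `𝔸_K`, `GL₂(𝔸_K)` and `N₂(𝔸_K)`
  haveI : T2Space (AdeleRing (𝓞 K) K) := t2Space_adeleRing K
  letI : MeasurableSpace (AdeleRing (𝓞 K) K) := borel _
  haveI : BorelSpace (AdeleRing (𝓞 K) K) := ⟨rfl⟩
  haveI : T2Space (GL (Fin 2) (AdeleRing (𝓞 K) K)) := t2Space_gl 2 K
  haveI : LocallyCompactSpace (GL (Fin 2) (AdeleRing (𝓞 K) K)) :=
    AdelicGroupData.locallyCompactSpace_generalLinearGroup_adeleRing K (Fin 2)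
  haveI : SecondCountableTopology (GL (Fin 2) (AdeleRing (𝓞 K) K)) :=
    secondCountableTopology_generalLinearGroup_adeleRing K (Fin 2)
  haveI : LocallyCompactSpace ↥(adelicUnipotent 2 K) := (isClosed_adelicUnipotent 2 K).locallyCompactSpace
  haveI hν₀R : (Measure.haar : Measure ↥(adelicUnipotent 2 K)).IsMulRightInvariant :=
    isMulRightInvariant_of_isHaarMeasure_adelicUnipotent _
  have hψ : IsGlobalAddChar K (adeleAddChar K) := isGlobalAddChar_adeleAddChar (K := K)
  have h𝓕 : IsFundamentalDomain ↥(rationalUnipotent 2 K) (unipotentTateDomain 2 K)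
      (Measure.haar : Measure ↥(adelicUnipotent 2 K)) :=
    isFundamentalDomain_unipotentTateDomain _
  set φ₀ : GL (Fin 2) (AdeleRing (𝓞 K) K) → ℂ := invQuot (AdelicGroupData.gl 2 K)
    (smoothedForm η ((f₀ : P.1.toSubmodule) : (AdelicGroupData.gl 2 K).L2 μ)) with hφ₀
  have hφinvK : IsLeftInvariant (AdelicGroupData.gl 2 K) φ₀ := isLeftInvariant_invQuot _ _
  set W : GL (Fin 2) (AdeleRing (𝓞 K) K) → ℂ :=
    whittakerCoeff (Measure.haar : Measure ↥(adelicUnipotent 2 K)) (unipotentTateDomain 2 K) (adeleAddChar K) φ₀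
    with hW
  -- `W(g ι s) = W(g)` (products in the `GL (Fin 2) 𝔸_K` spelling of `whittakerCoeff`)
  have hWright : ∀ (s : SL(2, v.adicCompletion K)) (g : GL (Fin 2) (AdeleRing (𝓞 K) K)),
      W (g * GLn.ofLocal 2 K v (Matrix.SpecialLinearGroup.toGL s)) = W g := by
    intro s g
    rw [hW, whittakerCoeff_mul_right]
    have : (fun x : GL (Fin 2) (AdeleRing (𝓞 K) K) => φ₀ (x * GLn.ofLocal 2 K v (Matrix.SpecialLinearGroup.toGL s))) = φ₀ :=
      funext fun x => hφ₀inv s x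
    rw [this]
  -- `W(ι(n y) g) = ψ_v(y) W(g)`
  have hWleft : ∀ (y : v.adicCompletion K) (g : GL (Fin 2) (AdeleRing (𝓞 K) K)),
      W (GLn.ofLocal 2 K v (Matrix.SpecialLinearGroup.toGL (SL2Mautner.upper y)) * g) =
        (adeleAddChar K).adicComponent v y * W g := by
    intro y g
    have hmul := whittakerCoeff_unipotent_mul (ν := (Measure.haar : Measure ↥(adelicUnipotent 2 K)))
      (𝓕 := unipotentTateDomain 2 K) (ψ := adeleAddChar K) h𝓕 hψ hφinvK
      ⟨slToAdelic v (SL2Mautner.upper y), slToAdelic_upper_mem_adelicUnipotent v y⟩ g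
    rw [whittakerCharFun_slToAdelic_upper] at hmul
    exact hmul
  -- `ι(n y) g₁ = g₁ ι(g₁ᵥ⁻¹ n(y) g₁ᵥ)` in the `GL (Fin 2) 𝔸_K` spelling
  have hconjGL : ∀ (y : v.adicCompletion K) (g : GL (Fin 2) (AdeleRing (𝓞 K) K)),
      GLn.ofLocal 2 K v (Matrix.SpecialLinearGroup.toGL (SL2Mautner.upper y)) * g =
        g * GLn.ofLocal 2 K v (Matrix.SpecialLinearGroup.toGL
          (SL2Mautner.conjSL (GLn.toLocalAt 2 K v g) (SL2Mautner.upper y))) :=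
    fun y g => slToAdelic_mul_eq v g (SL2Mautner.upper y)
  -- a point of non-vanishing
  have hcusp : ((f₀ : P.1.toSubmodule) : (AdelicGroupData.gl 2 K).L2 μ) ∈ cuspidalSubspace 2 K μ :=
    P.le_cuspidalSubspace f₀.2
  obtain ⟨g₁, hg₁⟩ := exists_whittakerCoeff_invQuot_smoothedForm_ne_zero_of_one_le (n := 2) (by norm_num) hηc hηs
    hcusp hne (Measure.haar : Measure ↥(adelicUnipotent 2 K))
  change W g₁ ≠ 0 at hg₁
  -- `ψ_v(y) W(g₁) = W(g₁)` for all `y`, hence `ψ_v = 1`: contradiction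
  have hψ1 : (adeleAddChar K).adicComponent v = 1 := by
    refine DFunLike.ext _ _ fun y => ?_
    have h1 := hWleft y g₁
    rw [hconjGL, hWright] at h1
    have h3 : ((adeleAddChar K).adicComponent v y : ℂ) * W g₁ = 1 * W g₁ := by rw [one_mul]; exact h1.symm
    have h2 : ((adeleAddChar K).adicComponent v y : ℂ) = 1 := mul_right_cancel₀ hg₁ h3
    rw [AddChar.one_apply]
    exact Subtype.ext h2
  exact adicComponent_adeleAddChar_ne_one (K := K) v hψ1

/-- **Howe–Moore decay along the mirabolic torus of one finite place, for cuspidal `Π` on `GL₂`.**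
For `u ∈ Π` (cuspidal automorphic representation of `GL₂(𝔸_K)`) and every `w ∈ L²`, the matrix
coefficient `⟪R(ι_v(diag(t, 1))) u, w⟫` tends to `0` as the unit `t` of `K_v` tends to `0`
(Howe–Moore (1979), Thm. 5.1 (irreducible representations of connected reductive groups over local fields) and Thm. 5.2 (simple groups, no finite-dimensional subrepresentations), for this action; proved from
`CuspidalAutomorphicRepGL.eq_zero_of_forall_lower_apply_eq`: the set
`{R(ι_v n̄(x))⁻¹ y - y} ∪ Π^⊥` is total, and the inner products of `R(ι_v(diag(t,1))) u` with its
members tend to `0` because `diag(t,1)⁻¹ n̄(x) diag(t,1) = n̄(t x) → 1` and `R` is strongly continuous,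
`tendsto_inner_zero_of_forall_mem`). This is what excludes bounded non-decaying characters from the
Kirillov asymptotics of cusp forms at `v`. [cite: HoweMoore1979, Thm. 5.1 and Thm. 5.2] -/
theorem CuspidalAutomorphicRepGL.tendsto_inner_rightRegular_diagOne (P : CuspidalAutomorphicRepGL 2 K μ)
    {u : (AdelicGroupData.gl 2 K).L2 μ} (huP : u ∈ P.1) (w : (AdelicGroupData.gl 2 K).L2 μ) :
    Tendsto (fun t : (v.adicCompletion K)ˣ =>
        ⟪R₂ (GLn.toAdelic 2 K v (SL2Mautner.diagOne t)) u, w⟫_ℂ)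
      (comap ((↑) : (v.adicCompletion K)ˣ → v.adicCompletion K) (𝓝 0)) (𝓝 0) := by
  refine tendsto_inner_zero_of_forall_mem (f := fun t : (v.adicCompletion K)ˣ =>
      R₂ (GLn.toAdelic 2 K v (SL2Mautner.diagOne t)) u) (C := ‖u‖)
    (fun t => (norm_rightRegular_apply' _ _).le)
    (Y := {y' | ∃ (x : v.adicCompletion K) (y : (AdelicGroupData.gl 2 K).L2 μ),
        y' = R₂ (slToAdelic v (SL2Mautner.lower x))⁻¹ y - y} ∪ (P.1.toSubmodule)ᗮ) ?_ ?_ w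
  · -- inner products with the members of `Y` tend to `0`
    rintro y' (⟨x, y, rfl⟩ | hy')
    · -- `⟪f t, R(l)⁻¹ y - y⟫ = ⟪R(l) f t - f t, y⟫` and `R(l) f t - f t = R(d t) (R(ι n̄(t x)) u - u)`
      have hconj : ∀ t : (v.adicCompletion K)ˣ,
          R₂ (slToAdelic v (SL2Mautner.lower x)) (R₂ (GLn.toAdelic 2 K v (SL2Mautner.diagOne t)) u) -
              R₂ (GLn.toAdelic 2 K v (SL2Mautner.diagOne t)) u =
            R₂ (GLn.toAdelic 2 K v (SL2Mautner.diagOne t))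
              (R₂ (slToAdelic v (SL2Mautner.lower ((t : v.adicCompletion K) * x))) u - u) := by
        intro t
        have he : slToAdelic v (SL2Mautner.lower x) * GLn.toAdelic 2 K v (SL2Mautner.diagOne t) =
            GLn.toAdelic 2 K v (SL2Mautner.diagOne t) *
              slToAdelic v (SL2Mautner.lower ((t : v.adicCompletion K) * x)) := by
          change GLn.toAdelic 2 K v (Matrix.SpecialLinearGroup.toGL (SL2Mautner.lower x)) *
              GLn.toAdelic 2 K v (SL2Mautner.diagOne t) =
            GLn.toAdelic 2 K v (SL2Mautner.diagOne t) *
              GLn.toAdelic 2 K v (Matrix.SpecialLinearGroup.toGL (SL2Mautner.lower ((t : v.adicCompletion K) * x)))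
          rw [← map_mul, ← map_mul, ← SL2Mautner.diagOne_inv_mul_lower_mul_diagOne, mul_assoc, mul_inv_cancel_left]
        rw [map_sub, ← mul_apply_eq_comp, ← mul_apply_eq_comp, ← map_mul, ← map_mul, he]
      -- `R(ι n̄(t x)) u → u` as `t → 0`
      have hcont : Tendsto (fun t : (v.adicCompletion K)ˣ =>
            R₂ (slToAdelic v (SL2Mautner.lower ((t : v.adicCompletion K) * x))) u)
          (comap ((↑) : (v.adicCompletion K)ˣ → v.adicCompletion K) (𝓝 0)) (𝓝 u) := by
        have hc := continuous_rightRegular_slToAdelic_transvection (μ := μ) v (show (1 : Fin 2) ≠ 0 by decide) u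
        have h0 : Tendsto (fun z : v.adicCompletion K => R₂ (slToAdelic v (SL2Mautner.lower z)) u) (𝓝 0) (𝓝 u) := by
          have h := hc.tendsto 0
          simp only [Matrix.SpecialLinearGroup.transvection_coeff_zero, map_one, one_apply_eq_self] at h
          exact h
        have hmul : Tendsto (fun t : (v.adicCompletion K)ˣ => (t : v.adicCompletion K) * x)
            (comap ((↑) : (v.adicCompletion K)ˣ → v.adicCompletion K) (𝓝 0)) (𝓝 0) := by
          have hc2 : Continuous fun z : v.adicCompletion K => z * x := continuous_id.mul continuous_const
          have := (hc2.tendsto (0 : v.adicCompletion K)).comp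
            (tendsto_comap (f := ((↑) : (v.adicCompletion K)ˣ → v.adicCompletion K)))
          simpa only [Function.comp_def, zero_mul] using this
        exact h0.comp hmul
      have hnorm : Tendsto (fun t : (v.adicCompletion K)ˣ =>
            ‖R₂ (slToAdelic v (SL2Mautner.lower x)) (R₂ (GLn.toAdelic 2 K v (SL2Mautner.diagOne t)) u) -
              R₂ (GLn.toAdelic 2 K v (SL2Mautner.diagOne t)) u‖)
          (comap ((↑) : (v.adicCompletion K)ˣ → v.adicCompletion K) (𝓝 0)) (𝓝 0) := by
        refine (tendsto_iff_norm_sub_tendsto_zero.1 hcont).congr fun t => ?_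
        rw [hconj t, norm_rightRegular_apply']
      rw [tendsto_zero_iff_norm_tendsto_zero]
      refine squeeze_zero (fun t => norm_nonneg _) (fun t => ?_) (by simpa using hnorm.mul_const ‖y‖)
      rw [inner_sub_right, inner_rightRegular_inv_right, ← inner_sub_left]
      exact norm_inner_le_norm _ _
    · -- members of `Π^⊥`: the inner products vanish since the translates of `u` stay in `Π`
      refine tendsto_const_nhds.congr fun t => ?_
      exact (Submodule.inner_right_of_mem_orthogonal (P.1.apply_mem _ huP) hy').symm
  · -- `Y` is total: a vector orthogonal to `Y` is an `N̄(K_v)`-invariant vector of `Π`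
    intro u' hu'
    have hlow : ∀ x : v.adicCompletion K, R₂ (slToAdelic v (SL2Mautner.lower x)) u' = u' := by
      intro x
      have hzero : ∀ y, ⟪y, R₂ (slToAdelic v (SL2Mautner.lower x)) u' - u'⟫_ℂ = 0 := by
        intro y
        have h := hu' (R₂ (slToAdelic v (SL2Mautner.lower x))⁻¹ y - y) (Or.inl ⟨x, y, rfl⟩)
        rw [inner_sub_left, ← inner_conj_symm, inner_rightRegular_inv_right, inner_conj_symm, ← inner_sub_right] at h
        exact h
      exact sub_eq_zero.1 (inner_self_eq_zero.1 (hzero _))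
    have hmemP : u' ∈ P.1 := by
      have horth : u' ∈ (P.1.toSubmodule)ᗮᗮ := by
        rw [Submodule.mem_orthogonal]
        intro y hy
        exact hu' y (Or.inr hy)
      rw [Submodule.orthogonal_orthogonal] at horth
      exact horth
    exact P.eq_zero_of_forall_lower_apply_eq v hmemP hlow

end Cuspidal
end Literature.NumberTheory.Automorphic
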